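import Literature.NumberTheory.EllipticCurves.PAdicLFunctionNeZeroProofs
import HarnessLib

/-!
# The interpolation property of `L_p(E, T)` holds unconditionally
# (`isPAdicLFunctionOf_padicLFunction_holds`; trunk EllArithM, item C19)

This file discharges the named fact `Literature.NumberTheory.EllipticCurves.isPAdicLFunctionOf_padicLFunction` of `PAdicLFunction`
(Mazur–Swinnerton-Dyer 1974, §9; Mazur–Tate–Teitelbaum 1986, §I.14, (14.3)): at a good ordinary
prime `p`, the power series `L_p(E, T) = L_p(f, α, T)` (`f` the newform of `E = W / ℚ`,
`α = unitRoot W p`) satisfies `IsPAdicLFunctionOf f p α`, i.e.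
`L_p(E, 0) = (1 - α⁻¹)² [0]⁺_f` and `L_p(E, χ(γ) - 1) = α⁻ᵐ ∑_{a mod p^m} χ(a) [a/p^m]⁺_f` for every
primitive even `p`-power-order character `χ` of conductor `p^m`, `m ≥ 1`.

`PAdicLFunctionNeZeroProofs.isPAdicLFunctionOf_padicLFunction_of_lattice` proved this from the single
named fact `isZLattice_periodLattice` (Eichler–Shimura: the period lattice `Λ_f` of a rational
newform is a lattice in `ℂ`). Inspection of that reduction shows that Eichler–Shimura enters only
through `plusPeriod_pos_and_realPeriods_eq` (`0 < Ω⁺_f` and `re Λ_f = ℤ · Ω⁺_f/2`) and through the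
rationality of `[r]⁺_f` it implies; Manin–Drinfeld for the newform of an elliptic curve is already a
theorem (`exists_nsmul_modularSymbol_mem_periodLattice_of_isNewformOf`, Drinfeld's argument with a
prime `ℓ ≡ 1 mod N`). We remove the remaining hypothesis by a case distinction on the definition
of the real period (`ModularSymbols.plusPeriod`):

* if `re Λ_f = ℤ · Ω/2` for some `Ω > 0` (the case guaranteed by Eichler–Shimura), then by
  definition `Ω⁺_f = Ω`, so `0 < Ω⁺_f ∧ re Λ_f = ℤ · Ω⁺_f/2` holds *by construction*
  (`plusPeriod_pos_and_realPeriods_eq_of_exists`), and the uniform Manin–Drinfeld denominator `n`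
  (`exists_forall_nsmul_modularSymbol_mem_periodLattice`: `n{∞, ±r} ∈ Λ_f`) gives
  `[r]_f = re (({∞, r} + {∞, -r})/2)/Ω⁺_f ∈ (1/4n)ℤ` exactly as in
  `exists_forall_normalizedPlusSymbol_eq_div` (Manin 1972, Cor. 3.6; Mazur–Tate–Teitelbaum 1986,
  §I.8: the `[r]⁺` "have bounded denominators");
* otherwise `Ω⁺_f = 0` is the documented junk value of `plusPeriod`, hence
  `[r]_f = re(…)/0 = 0` for all `r` (`normalizedPlusSymbol`, division by zero), so again
  `[r]_f ∈ (1/D)ℤ` with `D = 1`.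

In both cases `[r]_f ∈ ℚ` with bounded denominators
(`exists_forall_normalizedPlusSymbol_eq_div_of_maninDrinfeld`), whence
`([r]⁺ : ℝ) = [r]` (`ratCast_ratPlusSymbol_of_maninDrinfeld`, the input of the distribution relation
`sum_fiber_msdMeasure_succ_eq`) and the boundedness of `μ_{f,α}` for `|α|_p = 1`
(`exists_norm_msdMeasure_le_of_maninDrinfeld`, the input of the convergence of the Riemann sums
`tendsto_padicLRiemannSum_of_norm_le` and of the dominated-convergence step
`hasSum_padicLCoeff_mul_pow`). The assembly `isPAdicLFunctionOf_padicLFunction_holds` is then the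
proof of `isPAdicLFunctionOf_padicLFunction_of_lattice` verbatim with these inputs.

## What the discharged fact does and does not say

`IsPAdicLFunctionOf` compares `L_p(f, α, T)` with the *rational plus symbols* `[a/p^m]⁺_f`
(`ratPlusSymbol`), on both sides. That these equal `L(f, χ̄, 1)`-values — Birch's formula
`(∑ χ(a)[a/m]⁺) Ω⁺_f = τ(χ) L(f, χ̄, 1)` (`ratTwistedSymbolSum_mul_plusPeriod`) with `Ω⁺_f > 0`
(`IsNewform0.plusPeriod_pos`) — are separate named facts of `PAdicLFunction` / `ModularSymbols`,
and *they* need Eichler–Shimura (in the junk case `Ω⁺_f = 0` one has `L_p(E, T) = 0`, which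
Eichler–Shimura with Rohrlich's theorem excludes: `padicLFunction_ne_zero_of_lattice`). The present
file therefore does not touch `isZLattice_periodLattice`; it shows that the interpolation identity
(14.3), as vendored, is a theorem about the Mazur–Swinnerton-Dyer measure built from `[·]⁺_f`
whatever the normalising period is, which is also how Mazur–Tate–Teitelbaum §I.10–I.14 argue (the
distribution property and the evaluation at characters use only the Hecke relation (4.2) and the
bounded denominators of §I.8).

## Main results

* `plusPeriod_pos_and_realPeriods_eq_of_exists`, `plusPeriod_eq_zero_of_not_exists`: the two cases
  of the definition of `Ω⁺_f`.
* `exists_forall_normalizedPlusSymbol_eq_div_of_maninDrinfeld`,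
  `exists_forall_ratPlusSymbol_eq_div_of_maninDrinfeld`, `ratCast_ratPlusSymbol_of_maninDrinfeld`:
  bounded denominators and rationality of `[r]_f` from Manin–Drinfeld alone.
* `exists_norm_msdMeasure_le_of_maninDrinfeld`: `μ_{f,α}` is bounded for `|α|_p = 1`, from
  Manin–Drinfeld alone (Delbourgo 2008, Thm. 2.2; Mazur–Tate–Teitelbaum 1986, §I.11).
* `ratCast_ratPlusSymbol_of_maninDrinfeld_level`, `msdMeasure_distribution_of_maninDrinfeld`,
  `exists_norm_msdMeasure_le_of_maninDrinfeld_fact`, `tendsto_padicLRiemannSum_of_maninDrinfeld`: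
  the named facts `ratCast_ratPlusSymbol`, `msdMeasure_distribution`, `exists_norm_msdMeasure_le`,
  `tendsto_padicLRiemannSum` of `PAdicLFunction` (general rational newforms) now follow from the
  single named fact `exists_nsmul_modularSymbol_mem_periodLattice` (Manin–Drinfeld) — previously
  (`PAdicLFunctionDistributionProofs`, `PAdicLFunctionNeZeroProofs`) from Manin–Drinfeld and
  Eichler–Shimura.
* `msdMeasure_distribution_of_isNewformOf`, `exists_norm_msdMeasure_le_of_isNewformOf`,
  `tendsto_padicLRiemannSum_of_isNewformOf`: the distribution relation, boundedness and
  convergence of Riemann sums for the newform of an elliptic curve and its unit root,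
  unconditionally.
* `isPAdicLFunctionOf_padicLFunction_holds` : **the named fact
  `isPAdicLFunctionOf_padicLFunction`, sorry-free and hypothesis-free.**

## References

* B. Mazur, P. Swinnerton-Dyer, *Arithmetic of Weil curves*, Invent. Math. 25 (1974), 1–61, §8
  (the measure attached to a Weil parametrisation), §9 (the `p`-adic Mellin transform).
* B. Mazur, J. Tate, J. Teitelbaum, *On `p`-adic analogues of the conjectures of Birch and
  Swinnerton-Dyer*, Invent. Math. 84 (1986), 1–48, Ch. I §8 (bounded denominators of `[r]^±`),
  §10 (10.1)–(10.2) (the measure and its distribution property), §13 (the `p`-adic multiplier),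
  §14 (14.3) (interpolation).
* Ju. I. Manin, *Parabolic points and zeta functions of modular curves*, Izv. Akad. Nauk SSSR 36
  (1972), Cor. 3.6; V. G. Drinfeld, *Two theorems on modular curves*, Funct. Anal. Appl. 7 (1973).
* D. Delbourgo, *Elliptic curves and big Galois representations*, LMS LNS 356 (2008), Thm. 2.2.
-/

noncomputable section

open scoped MatrixGroups ModularForm

open CongruenceSubgroup Filter Topology Literature.NumberTheory.EllipticCurves.ModularForms

namespace Literature.NumberTheory.EllipticCurves.ModularForms

/-! ### The two cases of the definition of `Ω⁺_f` -/

section PlusPeriod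

variable {N : ℕ} (f : CuspForm (Gamma0 N) 2)

/-- **First case of the definition of `Ω⁺_f`**: if `re Λ_f = ℤ · Ω/2` for some `Ω > 0`, then
`Ω⁺_f > 0` and `re Λ_f = ℤ · Ω⁺_f/2` — by the definition of `plusPeriod` as `h.choose`, with no
appeal to Eichler–Shimura (compare `plusPeriod_pos_and_realPeriods_eq`, which derives the
hypothesis from `isZLattice_periodLattice`). [folklore] -/
theorem plusPeriod_pos_and_realPeriods_eq_of_exists
    (h : ∃ Ω : ℝ, 0 < Ω ∧ realPeriods f = AddSubgroup.zmultiples (Ω / 2)) :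
    0 < plusPeriod f ∧ realPeriods f = AddSubgroup.zmultiples (plusPeriod f / 2) := by
  have hΩ : plusPeriod f = h.choose := by simp only [plusPeriod, dif_pos h]
  rw [hΩ]
  exact h.choose_spec

/-- **Second case of the definition of `Ω⁺_f`**: if `re Λ_f` is not of the form `ℤ · Ω/2` with
`Ω > 0`, then `Ω⁺_f = 0` (the documented junk value of `plusPeriod`). [folklore] -/
theorem plusPeriod_eq_zero_of_not_exists
    (h : ¬ ∃ Ω : ℝ, 0 < Ω ∧ realPeriods f = AddSubgroup.zmultiples (Ω / 2)) :
    plusPeriod f = 0 := by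
  simp only [plusPeriod, dif_neg h]

/-- In the junk case `Ω⁺_f = 0` every normalised plus symbol vanishes: `[r]_f = re(…)/0 = 0`.
[folklore] -/
theorem normalizedPlusSymbol_eq_zero_of_plusPeriod_eq_zero (h : plusPeriod f = 0) (r : ℚ) :
    normalizedPlusSymbol f r = 0 := by
  rw [normalizedPlusSymbol, h, div_zero]

end PlusPeriod

/-! ### Rationality and bounded denominators of `[r]⁺` from Manin–Drinfeld alone -/

section Rationality

variable {N : ℕ} [NeZero N] {f : CuspForm (Gamma0 N) 2}

/-- **Bounded denominators of `[r] = re plusSymbol(r)/Ω⁺` from Manin–Drinfeld alone**: if every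
`{∞, r}_f` has a positive multiple in `Λ_f` (`exists_nsmul_modularSymbol_mem_periodLattice`), there
is one `D > 0` with `[r]_f ∈ (1/D)ℤ` for all `r ∈ ℚ`. If `re Λ_f = ℤ · Ω/2` with `Ω > 0` this is
the argument of `exists_forall_normalizedPlusSymbol_eq_div` (`D = 4n`, `n` the uniform
Manin–Drinfeld denominator of `exists_forall_nsmul_modularSymbol_mem_periodLattice`:
`re (n{∞, ±r}) ∈ re Λ_f = ℤ Ω⁺/2`); otherwise `Ω⁺_f = 0` and `[r]_f = 0`, `D = 1`
(Manin 1972, Cor. 3.6; Mazur–Tate–Teitelbaum 1986, §I.8). [cite: Manin1972, Cor. 3.6] -/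
theorem exists_forall_normalizedPlusSymbol_eq_div_of_maninDrinfeld
    (hMD : exists_nsmul_modularSymbol_mem_periodLattice f) :
    ∃ D : ℕ, 0 < D ∧ ∀ r : ℚ, ∃ m : ℤ, normalizedPlusSymbol f r = (m : ℝ) / D := by
  by_cases h : ∃ Ω : ℝ, 0 < Ω ∧ realPeriods f = AddSubgroup.zmultiples (Ω / 2)
  · obtain ⟨hpos, hre⟩ := plusPeriod_pos_and_realPeriods_eq_of_exists f h
    obtain ⟨n, hn, hmem⟩ := exists_forall_nsmul_modularSymbol_mem_periodLattice f hMD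
    refine ⟨4 * n, by omega, fun r ↦ ?_⟩
    have h1 : (n • modularSymbol f r).re ∈ realPeriods f := AddSubgroup.mem_map_of_mem _ (hmem r)
    have h2 : (n • modularSymbol f (-r)).re ∈ realPeriods f :=
      AddSubgroup.mem_map_of_mem _ (hmem (-r))
    rw [hre, AddSubgroup.mem_zmultiples_iff] at h1 h2
    obtain ⟨k₁, hk₁⟩ := h1
    obtain ⟨k₂, hk₂⟩ := h2
    refine ⟨k₁ + k₂, ?_⟩
    rw [Complex.re_nsmul, nsmul_eq_mul, zsmul_eq_mul] at hk₁ hk₂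
    have hn' : (n : ℝ) ≠ 0 := by exact_mod_cast hn.ne'
    have hplus : (plusSymbol f r).re =
        ((modularSymbol f r).re + (modularSymbol f (-r)).re) / 2 := by
      rw [plusSymbol, Complex.div_ofNat_re, Complex.add_re]
    have hΩ0 : plusPeriod f ≠ 0 := hpos.ne'
    rw [normalizedPlusSymbol, hplus]
    push_cast
    field_simp
    linarith [hk₁, hk₂]
  · refine ⟨1, one_pos, fun r ↦ ⟨0, ?_⟩⟩
    rw [normalizedPlusSymbol_eq_zero_of_plusPeriod_eq_zero f (plusPeriod_eq_zero_of_not_exists f h),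
      Int.cast_zero, zero_div]

/-- **Bounded denominators of the rational plus symbols `[r]⁺ = ratPlusSymbol f r` from
Manin–Drinfeld alone**: one `D > 0` with `ratPlusSymbol f r ∈ (1/D)ℤ` for all `r`
(Manin 1972, Cor. 3.6; Mazur–Tate–Teitelbaum 1986, §I.8). [cite: Manin1972, Cor. 3.6] -/
theorem exists_forall_ratPlusSymbol_eq_div_of_maninDrinfeld
    (hMD : exists_nsmul_modularSymbol_mem_periodLattice f) :
    ∃ D : ℕ, 0 < D ∧ ∀ r : ℚ, ∃ m : ℤ, ratPlusSymbol f r = (m : ℚ) / D := by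
  obtain ⟨D, hD, h⟩ := exists_forall_normalizedPlusSymbol_eq_div_of_maninDrinfeld hMD
  refine ⟨D, hD, fun r ↦ ?_⟩
  obtain ⟨m, hm⟩ := h r
  refine ⟨m, ?_⟩
  have hex : ∃ q : ℚ, (q : ℝ) = normalizedPlusSymbol f r := ⟨m / D, by rw [hm]; push_cast; rfl⟩
  rw [ratPlusSymbol, dif_pos hex]
  apply Rat.cast_injective (α := ℝ)
  rw [hex.choose_spec, hm]
  push_cast
  rfl

/-- **`([r]⁺ : ℝ) = [r]` from Manin–Drinfeld alone**: the rational plus symbol `ratPlusSymbol f r`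
casts to `normalizedPlusSymbol f r`, because the latter is rational
(`exists_forall_normalizedPlusSymbol_eq_div_of_maninDrinfeld`; in the junk case `Ω⁺_f = 0` both
sides are `0`) (Mazur–Tate–Teitelbaum 1986, §I.8). [cite: MazurTateTeitelbaum1986Invent, §I.8] -/
theorem ratCast_ratPlusSymbol_of_maninDrinfeld
    (hMD : exists_nsmul_modularSymbol_mem_periodLattice f) (r : ℚ) :
    (ratPlusSymbol f r : ℝ) = normalizedPlusSymbol f r := by
  obtain ⟨D, _, h⟩ := exists_forall_normalizedPlusSymbol_eq_div_of_maninDrinfeld hMD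
  obtain ⟨m, hm⟩ := h r
  have hex : ∃ q : ℚ, (q : ℝ) = normalizedPlusSymbol f r := ⟨m / D, by rw [hm]; push_cast; rfl⟩
  rw [ratPlusSymbol, dif_pos hex]
  exact hex.choose_spec

end Rationality

end Literature.NumberTheory.EllipticCurves.ModularForms

namespace Literature.NumberTheory.EllipticCurves

/-! ### Boundedness of `μ_{f,α}` from Manin–Drinfeld alone -/

section Boundedness

variable {N : ℕ} [NeZero N] {f : CuspForm (Gamma0 N) 2} {p : ℕ} [Fact p.Prime]

/-- **`μ_{f,α}` is bounded for `|α|_p = 1`, from Manin–Drinfeld alone** (Mazur–Tate–Teitelbaum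
1986, §I.11; Delbourgo 2008, Thm. 2.2: "if `a_p(f)` is a `p`-adic unit then `μ_{f,α_p}` is a
bounded measure"): with `D` the common denominator of the `[r]⁺_f`
(`exists_forall_ratPlusSymbol_eq_div_of_maninDrinfeld`) one has `|[r]⁺|_p ≤ |1/D|_p`, hence
`|μ(a + pⁿℤ_p)|_p ≤ 2 |1/D|_p` as `|α⁻¹|_p = 1` (the proof of
`exists_norm_msdMeasure_le_of_lattice` with the Eichler–Shimura hypothesis removed).
[cite: Delbourgo2008, Thm. 2.2 (PDF p. 41)] -/
theorem exists_norm_msdMeasure_le_of_maninDrinfeld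
    (hMD : exists_nsmul_modularSymbol_mem_periodLattice f) {α : ℚ_[p]} (hαu : ‖α‖ = 1) :
    ∃ C : ℝ, ∀ (n : ℕ) (a : ZMod (p ^ n)), ‖msdMeasure f α n a‖ ≤ C := by
  obtain ⟨D, hD, hden⟩ := exists_forall_ratPlusSymbol_eq_div_of_maninDrinfeld hMD
  set C : ℝ := ‖(D : ℚ_[p])‖⁻¹ with hC
  have hC0 : 0 ≤ C := inv_nonneg.mpr (norm_nonneg _)
  have hbd : ∀ r : ℚ, ‖(ratPlusSymbol f r : ℚ_[p])‖ ≤ C := fun r ↦ by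
    obtain ⟨m, hm⟩ := hden r
    rw [hm]
    push_cast
    rw [norm_div, div_eq_mul_inv]
    exact mul_le_of_le_one_left hC0 (Padic.norm_int_le_one m)
  have hαi : ‖α⁻¹‖ = 1 := by rw [norm_inv, hαu, inv_one]
  refine ⟨2 * C, fun n a ↦ ?_⟩
  cases n with
  | zero =>
    simp only [msdMeasure]
    calc ‖(1 - α⁻¹) * (ratPlusSymbol f 0 : ℚ_[p])‖
        = ‖1 - α⁻¹‖ * ‖((ratPlusSymbol f 0 : ℚ) : ℚ_[p])‖ := norm_mul _ _
      _ ≤ (‖(1 : ℚ_[p])‖ + ‖α⁻¹‖) * C :=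
          mul_le_mul (norm_sub_le _ _) (hbd 0) (norm_nonneg _) (by positivity)
      _ = 2 * C := by rw [norm_one, hαi]; ring
  | succ n =>
    simp only [msdMeasure]
    calc ‖α⁻¹ ^ (n + 1) * (ratPlusSymbol f ((a.val : ℚ) / (p : ℚ) ^ (n + 1)) : ℚ_[p]) -
          α⁻¹ ^ (n + 2) * (ratPlusSymbol f ((a.val : ℚ) / (p : ℚ) ^ n) : ℚ_[p])‖
        ≤ ‖α⁻¹ ^ (n + 1) * (ratPlusSymbol f ((a.val : ℚ) / (p : ℚ) ^ (n + 1)) : ℚ_[p])‖ +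
          ‖α⁻¹ ^ (n + 2) * (ratPlusSymbol f ((a.val : ℚ) / (p : ℚ) ^ n) : ℚ_[p])‖ :=
          norm_sub_le _ _
      _ ≤ C + C := by
          refine add_le_add ?_ ?_ <;>
          · rw [norm_mul, norm_pow, hαi, one_pow, one_mul]
            exact hbd _
      _ = 2 * C := by ring

end Boundedness

/-! ### The level-`N` named facts from Manin–Drinfeld alone -/

section LevelFacts

variable {N : ℕ} {p : ℕ} [Fact p.Prime]

/-- **Reduction of the named fact `ratCast_ratPlusSymbol`** (level `N`: `([r]⁺ : ℝ) = [r]` for the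
rational newforms of level `N`; Mazur–Tate–Teitelbaum 1986, §I.8) to Manin–Drinfeld for the cusp
forms of level `N` alone (`exists_nsmul_modularSymbol_mem_periodLattice`, Manin 1972, Cor. 3.6),
sharpening `ratCast_ratPlusSymbol_of` (which also assumed Eichler–Shimura). The newform and
rationality hypotheses of the fact are not even needed. (The hypothesis quantifies over the
instance `[NeZero N]` exactly as the named fact does.) [cite: MazurTateTeitelbaum1986Invent, §I.8] -/
theorem ratCast_ratPlusSymbol_of_maninDrinfeld_level
    (hMD : ∀ [NeZero N] (g : CuspForm (Gamma0 N) 2),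
      exists_nsmul_modularSymbol_mem_periodLattice g) :
    ratCast_ratPlusSymbol (N := N) := by
  intro _ g _ _ r
  exact ratCast_ratPlusSymbol_of_maninDrinfeld (hMD g) r

/-- **Reduction of the named fact `msdMeasure_distribution`** (the distribution relation of
`μ_{g,α}` for the rational newforms `g` of level `N` prime to `p` and the roots `α` of
`X² - a_p X + p`; Mazur–Tate–Teitelbaum 1986, §I.10 Prop. (10.2)) to Manin–Drinfeld for the cusp
forms of level `N` alone, sharpening `msdMeasure_distribution_of` (which also assumed
Eichler–Shimura): `sum_fiber_msdMeasure_succ_eq` fed with `ratCast_ratPlusSymbol_of_maninDrinfeld`.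
[cite: MazurTateTeitelbaum1986Invent, §I.10 Prop. (10.2)] -/
theorem msdMeasure_distribution_of_maninDrinfeld
    (hMD : ∀ [NeZero N] (g : CuspForm (Gamma0 N) 2),
      exists_nsmul_modularSymbol_mem_periodLattice g) :
    msdMeasure_distribution (N := N) (p := p) := by
  intro _ g hg _ hpN _ hap _ hα₀ hα n a
  exact sum_fiber_msdMeasure_succ_eq (ratCast_ratPlusSymbol_of_maninDrinfeld (hMD g)) hg hpN hap
    hα₀ hα n a

variable [NeZero N] {f : CuspForm (Gamma0 N) 2}

/-- **Reduction of the named fact `exists_norm_msdMeasure_le`** (boundedness of `μ_{f,α}` for the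
unit root; Delbourgo 2008, Thm. 2.2; Mazur–Tate–Teitelbaum 1986, §I.11) to Manin–Drinfeld for `f`
alone, sharpening `exists_norm_msdMeasure_le_of` / `exists_norm_msdMeasure_le_of_lattice'`.
[cite: Delbourgo2008, Thm. 2.2 (PDF p. 41)] -/
theorem exists_norm_msdMeasure_le_of_maninDrinfeld_fact
    (hMD : exists_nsmul_modularSymbol_mem_periodLattice f) :
    exists_norm_msdMeasure_le (f := f) (p := p) :=
  fun _ _ _ _ _ _ _ hαu ↦ exists_norm_msdMeasure_le_of_maninDrinfeld hMD hαu

/-- **Reduction of the named fact `tendsto_padicLRiemannSum`** (convergence of the Riemann sums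
defining the coefficients of `L_p(f, α, T)` for a rational newform `f` of level prime to `p` and
its unit root `α`; Mazur–Tate–Teitelbaum 1986, §I.11–I.13) to Manin–Drinfeld for `f` alone,
sharpening `tendsto_padicLRiemannSum_of_lattice`: the distribution relation
(`sum_fiber_msdMeasure_succ_eq` with `ratCast_ratPlusSymbol_of_maninDrinfeld`) and the boundedness
(`exists_norm_msdMeasure_le_of_maninDrinfeld`) feed the Cauchy estimate
`tendsto_padicLRiemannSum_of_norm_le`. [cite: MazurTateTeitelbaum1986Invent, §I.11–I.13] -/
theorem tendsto_padicLRiemannSum_of_maninDrinfeld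
    (hMD : exists_nsmul_modularSymbol_mem_periodLattice f) :
    tendsto_padicLRiemannSum (f := f) (p := p) := by
  intro hf _ hpN ap hap α hα hαu k
  have hα0 : α ≠ 0 := norm_ne_zero_iff.mp (by rw [hαu]; exact one_ne_zero)
  exact tendsto_padicLRiemannSum_of_norm_le
    (fun n a ↦ sum_fiber_msdMeasure_succ_eq (ratCast_ratPlusSymbol_of_maninDrinfeld hMD) hf hpN hap
      hα0 hα n a)
    (exists_norm_msdMeasure_le_of_maninDrinfeld hMD hαu) k

end LevelFacts

/-! ### The newform of an elliptic curve: distribution, boundedness, convergence, interpolation -/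

section Elliptic

variable {N : ℕ} [NeZero N] {f : CuspForm (Gamma0 N) 2} {p : ℕ} [Fact p.Prime]
  {W : WeierstrassCurve ℚ} [W.IsGloballyMinimal] [W.IsElliptic]

omit [W.IsElliptic] in
/-- **The unit root in `ℚ_p`**: at a good ordinary prime, `α = unitRoot W p` satisfies
`α² - a_p(W) α + p = 0` in `ℚ_p`, `|α|_p = 1` and `α ≠ 0` (`unitRoot_spec_holds`, Hensel;
Mazur–Tate–Teitelbaum 1986, §I.11). [cite: MazurTateTeitelbaum1986Invent, §I.11] -/
theorem unitRoot_coe_spec (hord : IsOrdinaryAt W p) :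
    (unitRoot W p : ℚ_[p]) ^ 2 - ((W.frobeniusTrace p : ℤ) : ℚ_[p]) * (unitRoot W p : ℚ_[p]) + p
        = 0 ∧
      ‖(unitRoot W p : ℚ_[p])‖ = 1 ∧ (unitRoot W p : ℚ_[p]) ≠ 0 := by
  have hspec := unitRoot_spec_holds W p hord
  have hαeq : (unitRoot W p : ℚ_[p]) ^ 2 -
      ((W.frobeniusTrace p : ℤ) : ℚ_[p]) * (unitRoot W p : ℚ_[p]) + p = 0 := by
    have h := congr_arg ((↑) : ℤ_[p] → ℚ_[p]) hspec.1
    push_cast at h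
    exact h
  have hαu : ‖(unitRoot W p : ℚ_[p])‖ = 1 := norm_unitRoot_holds W p hord
  exact ⟨hαeq, hαu, norm_ne_zero_iff.mp (by rw [hαu]; exact one_ne_zero)⟩

/-- **Distribution relation of `μ_{f,α}` for the newform of `E` and its unit root,
unconditionally** (Mazur–Tate–Teitelbaum 1986, §I.10, Prop. (10.2); Mazur–Swinnerton-Dyer 1974,
§8): `∑_{b ≡ a mod pⁿ} μ(b + pⁿ⁺¹ℤ_p) = μ(a + pⁿℤ_p)`, by `sum_fiber_msdMeasure_succ_eq` (the Hecke
relation (4.2)) fed with the rationality `([r]⁺ : ℝ) = [r]` from Manin–Drinfeld for `f`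
(`exists_nsmul_modularSymbol_mem_periodLattice_of_isNewformOf`), `a_p(f) = a_p(E)`
(`cuspCoeff_eq_frobeniusTrace_of_isNewformOf_holds`) and `p ∤ N` (`not_dvd_level_of_isNewformOf`).
[cite: MazurTateTeitelbaum1986Invent, §I.10 Prop. (10.2)] -/
theorem msdMeasure_distribution_of_isNewformOf (hord : IsOrdinaryAt W p) (hf : IsNewformOf W f)
    (n : ℕ) (a : ZMod (p ^ n)) :
    ∑ b ∈ Finset.univ.filter (fun b : ZMod (p ^ (n + 1)) ↦
        ZMod.castHom (pow_dvd_pow p n.le_succ) (ZMod (p ^ n)) b = a),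
      msdMeasure f (unitRoot W p : ℚ_[p]) (n + 1) b = msdMeasure f (unitRoot W p : ℚ_[p]) n a := by
  obtain ⟨hαeq, _, hα0⟩ := unitRoot_coe_spec (W := W) hord
  exact sum_fiber_msdMeasure_succ_eq
    (ratCast_ratPlusSymbol_of_maninDrinfeld
      (exists_nsmul_modularSymbol_mem_periodLattice_of_isNewformOf hf))
    hf.1 (not_dvd_level_of_isNewformOf hf hord.1)
    (cuspCoeff_eq_frobeniusTrace_of_isNewformOf_holds hf hord.1) hα0 hαeq n a

/-- **`μ_{f,α}` is bounded for the newform of `E` and its unit root, unconditionally**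
(Mazur–Tate–Teitelbaum 1986, §I.11; Delbourgo 2008, Thm. 2.2), by
`exists_norm_msdMeasure_le_of_maninDrinfeld` and Manin–Drinfeld for `f`.
[cite: Delbourgo2008, Thm. 2.2 (PDF p. 41)] -/
theorem exists_norm_msdMeasure_le_of_isNewformOf (hord : IsOrdinaryAt W p) (hf : IsNewformOf W f) :
    ∃ C : ℝ, ∀ (n : ℕ) (a : ZMod (p ^ n)), ‖msdMeasure f (unitRoot W p : ℚ_[p]) n a‖ ≤ C :=
  exists_norm_msdMeasure_le_of_maninDrinfeld
    (exists_nsmul_modularSymbol_mem_periodLattice_of_isNewformOf hf) (unitRoot_coe_spec hord).2.1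

/-- **Convergence of the Riemann sums defining `L_p(E, T)`, unconditionally**: for the newform `f`
of `E` and its unit root `α`, `padicLRiemannSum f α k n → padicLCoeff f α k`
(`tendsto_padicLRiemannSum_of_norm_le`: the distribution relation and the boundedness make the
Riemann sums Cauchy; Mazur–Tate–Teitelbaum 1986, §I.11–I.13).
[cite: MazurTateTeitelbaum1986Invent, §I.11–I.13] -/
theorem tendsto_padicLRiemannSum_of_isNewformOf (hord : IsOrdinaryAt W p) (hf : IsNewformOf W f)
    (k : ℕ) :
    Tendsto (padicLRiemannSum f (unitRoot W p : ℚ_[p]) k) atTop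
      (𝓝 (padicLCoeff f (unitRoot W p : ℚ_[p]) k)) :=
  tendsto_padicLRiemannSum_of_norm_le (msdMeasure_distribution_of_isNewformOf hord hf)
    (exists_norm_msdMeasure_le_of_isNewformOf hord hf) k

/-- **Mazur–Swinnerton-Dyer / Mazur–Tate–Teitelbaum interpolation property of `L_p(E, T)`**
(discharge of the named fact `isPAdicLFunctionOf_padicLFunction`; Mazur–Swinnerton-Dyer 1974, §9;
Mazur–Tate–Teitelbaum 1986, §I.14, (14.3)): at a good ordinary prime `p`, with `f` the newform of
`E = W / ℚ` and `α = unitRoot W p`, the power series `L_p(E, T) = L_p(f, α, T)` has constant term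
`(1 - α⁻¹)² [0]⁺_f` (`padicLRiemannSum_zero`: the Riemann sums for `k = 0` all equal `μ(ℤ_p^×)`) and
`∑_k c_k (χ(γ) - 1)^k = α⁻ᵐ ∑_{a mod p^m} χ(a) [a/p^m]⁺_f` for every primitive even `p`-power-order
`χ` of conductor `p^m`, `m ≥ 1` (`hasSum_padicLCoeff_mul_pow`: evaluation of the level-`n` Riemann
sums against `χ` and dominated convergence). The inputs — distribution relation, boundedness and
convergence for `μ_{f,α}` — are the unconditional theorems above; no named fact remains as a
hypothesis. [cite: MazurSwinnertonDyer1974Invent, §9] -/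
theorem isPAdicLFunctionOf_padicLFunction_holds :
    isPAdicLFunctionOf_padicLFunction (f := f) (p := p) (W := W) := by
  intro hord hf
  have hdist := msdMeasure_distribution_of_isNewformOf (f := f) hord hf
  have hbdd := exists_norm_msdMeasure_le_of_isNewformOf (f := f) hord hf
  have htend := tendsto_padicLRiemannSum_of_isNewformOf (f := f) hord hf
  refine ⟨?_, fun m hm χ hχ heven hordχ ↦ ?_⟩
  · -- constant term
    rw [constantCoeff_padicLFunction, padicLCoeff,
      (tendsto_const_nhds.congr fun n ↦ (padicLRiemannSum_zero hdist n).symm).limUnder_eq]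
  · -- interpolation at `χ` of conductor `p^m`, `m = m' + 1`
    obtain ⟨m, rfl⟩ := Nat.exists_eq_succ_of_ne_zero hm.ne'
    simp only [coeff_padicLFunction]
    exact hasSum_padicLCoeff_mul_pow hdist ratPlusSymbol_add_intCast_holds htend hbdd χ hχ heven
      hordχ

end Elliptic

end Literature.NumberTheory.EllipticCurves
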